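import Mathlib
import HarnessLib

/-!
# The regular (recessive) branch at a singularity of the first kind with `C¹` coefficient and REAL
# exponent gap: Levinson's integral equation with real powers

Topic `Literature/Analysis/ODE` (namespace `Literature.Analysis.ODE`).  The sibling `RegularSingularC1Branch.lean`
constructs the regular branch of `x w′ = K(x) w`, `K(x) = K₀ + x·G(x)` (`G` continuous on `[0, δ₀]`, `E` a real
Banach space) when the residue satisfies `K₀ ∘ K₀ = −n K₀` with an INTEGER gap `n ≥ 1` (natural powers `xⁿ`
suffice there: the axis of the screw pinch, indicial exponents `±m`).  At a RESONANT SURFACE of Newcomb's equation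
(`f ∼ (r − rₛ)²`; Freidberg2014 §11.4.2/§11.5.3: `ξ = c₁ x^{p₁} + c₂ x^{p₂}`, `p₁,₂ = −½ ± ½(1 − 4Dₛ)^{1/2}` real
under Suydam's criterion) the gap `p₁ − p₂ = (1 − 4Dₛ)^{1/2}` is an arbitrary positive real number.  This file is
the same theorem and the same proof with a REAL gap `ν > 0` and real powers `x^ν` (`Real.rpow`):

  `w(x) = v₀ + (1 − P) ∫₀ˣ G(s) w(s) ds + x^{−ν} P ∫₀ˣ s^ν G(s) w(s) ds`,  `P = −K₀/ν`,

a contraction on bounded continuous functions for `δ(1 + 2‖P‖) sup‖G‖ ≤ ½`, Banach fixed point, fundamental theorem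
of calculus, and the averaging limit `x^{−(ν+1)} ∫₀ˣ s^ν h(s) ds → h(0)/(ν+1)` for the continuity of `w′` at `0`
(CoddingtonLevinson1955 Ch. 3 §8 Theorem 8.1 with the split integral equation (8.13), in the variable `x = e^{−t}`).

THE THEOREMS (all proved; no definitions, no named facts):
* `exists_regularBranch_real` — `K₀ ∘ K₀ = −ν K₀` (`ν > 0` real), `K₀ v₀ = 0` ⇒ a solution `w` on `[0, δ]`, `C¹` up
  to and including `x = 0` (`w, w′` continuous on `[0, δ]`, right derivative at `0`), `w(0) = v₀`, `x w′ = K(x) w`.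
* `exists_regularBranch_rpow` — the exponent shift: `N(s) = N₀ + s·G(s)`, `(N₀ − λ)∘(N₀ − λ) = −ν (N₀ − λ)` (for a
  `2 × 2` residue with real eigenvalues `λ > λ′`: `ν = λ − λ′`, Cayley–Hamilton), `N₀ v₀ = λ v₀` ⇒ `w` as above with
  `x w′ = N(x) w − λ w`, and `v = x^λ w` solves `v′ = x⁻¹ N(x) v` on `(0, δ)`: the branch `v ∼ x^λ v₀`.

## References (read on the page, 2026-08-27)
* E. A. Coddington, N. Levinson, *Theory of Ordinary Differential Equations*, McGraw–Hill 1955: Ch. 3 §8 Theorem 8.1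
  and its proof by the split integral equation (8.13) [galaxy:panama:394716084436999 p0111–p0113]; Ch. 4 §2.  Key
  `CoddingtonLevinson1955`.
* J. P. Freidberg, *Ideal MHD*, CUP 2014: §11.5.3 "Internal mode stability when `F(rₛ) = 0`" (the exponents
  `p₁, p₂` at a resonant surface, eq. (11.104), and the small solution (11.115)) [galaxy:panama:388488381857833
  p0388].  Key `Freidberg2014`.
* P. Hartman, *Ordinary Differential Equations*, SIAM 2002, Ch. X §17.  Key `Hartman2002`.

## Deliberately NOT here
The integer-gap file is not re-derived from this one (it stands as landed); uniqueness of the branch; the dominant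
branch `∼ x^{−ν}`; logarithmic / complex-exponent cases; continuation away from the singular point.
-/

noncomputable section

open Set MeasureTheory intervalIntegral Filter
open scoped Topology BoundedContinuousFunction

namespace Literature.Analysis.ODE

variable {E : Type*} [NormedAddCommGroup E] [NormedSpace ℝ E]

/-! ### The averaging limit with a real power -/

/-- **Averaging limit, real power.** If `h` is continuous on `[0, δ]` and `p ≥ 0` then
`x^{-(p+1)} ∫₀ˣ sᵖ h(s) ds → h(0)/(p+1)` as `x → 0⁺`.  Private (an uncited calculus helper). [folklore] -/
private theorem tendsto_inv_rpow_smul_integral [CompleteSpace E] {h : ℝ → E} {δ : ℝ} (hδ : 0 < δ)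
    (hh : ContinuousOn h (Icc 0 δ)) {p : ℝ} (hp : 0 ≤ p) :
    Tendsto (fun x : ℝ => (x ^ (p + 1))⁻¹ • ∫ s in (0 : ℝ)..x, s ^ p • h s) (𝓝[>] 0)
      (𝓝 (((p + 1))⁻¹ • h 0)) := by
  rw [Metric.tendsto_nhdsWithin_nhds]
  intro ε hε
  have hp1 : (0 : ℝ) < p + 1 := by linarith
  have hpc : Continuous fun s : ℝ => s ^ p := Real.continuous_rpow_const hp
  -- continuity of `h` at `0` within `[0, δ]`
  have hc0 : ContinuousWithinAt h (Icc 0 δ) 0 := hh 0 ⟨le_rfl, hδ.le⟩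
  rw [Metric.continuousWithinAt_iff] at hc0
  obtain ⟨η, hη, hηε⟩ := hc0 (ε / 2) (half_pos hε)
  refine ⟨min η δ, lt_min hη hδ, fun x hx hxd => ?_⟩
  rw [mem_Ioi] at hx
  rw [dist_eq_norm, Real.norm_eq_abs, sub_zero, abs_of_pos hx] at hxd
  have hxη : x < η := lt_of_lt_of_le hxd (min_le_left _ _)
  have hxδ : x < δ := lt_of_lt_of_le hxd (min_le_right _ _)
  have hxp : 0 < x ^ (p + 1) := Real.rpow_pos_of_pos hx _
  -- integrability of the two pieces on `[0, x]`
  have hhx : ContinuousOn h (uIcc 0 x) := by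
    rw [uIcc_of_le hx.le]; exact hh.mono (Icc_subset_Icc_right hxδ.le)
  have hint : IntervalIntegrable (fun s => s ^ p • h s) volume 0 x :=
    (hpc.continuousOn.smul hhx).intervalIntegrable
  have hint0 : IntervalIntegrable (fun s : ℝ => s ^ p • h 0) volume 0 x :=
    (hpc.continuousOn.smul continuousOn_const).intervalIntegrable
  -- `∫₀ˣ sᵖ ds • h 0 = x^{p+1}/(p+1) • h 0`
  have hI0 : (∫ s in (0 : ℝ)..x, s ^ p • h 0) = (x ^ (p + 1) / (p + 1)) • h 0 := by
    rw [intervalIntegral.integral_smul_const, integral_rpow (Or.inl (by linarith)),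
      Real.zero_rpow hp1.ne', sub_zero]
  -- the difference as one integral
  have hdiff : (x ^ (p + 1))⁻¹ • (∫ s in (0 : ℝ)..x, s ^ p • h s) - ((p + 1))⁻¹ • h 0
      = (x ^ (p + 1))⁻¹ • ∫ s in (0 : ℝ)..x, s ^ p • (h s - h 0) := by
    have e1 : (∫ s in (0 : ℝ)..x, s ^ p • (h s - h 0))
        = (∫ s in (0 : ℝ)..x, s ^ p • h s) - ∫ s in (0 : ℝ)..x, s ^ p • h 0 := by
      rw [← intervalIntegral.integral_sub hint hint0]
      congr 1; funext s; rw [smul_sub]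
    rw [e1, smul_sub, hI0, smul_smul]
    congr 1
    field_simp
  rw [dist_eq_norm, hdiff, norm_smul, norm_inv, Real.norm_eq_abs, abs_of_pos hxp]
  -- bound the integral
  have hbound : ‖∫ s in (0 : ℝ)..x, s ^ p • (h s - h 0)‖ ≤ (ε / 2) * x ^ (p + 1) := by
    have hle : ∀ s ∈ Set.uIoc (0 : ℝ) x, ‖s ^ p • (h s - h 0)‖ ≤ x ^ p * (ε / 2) := by
      intro s hs
      rw [uIoc_of_le hx.le] at hs
      have hs0 : 0 ≤ s := hs.1.le
      have hsI : s ∈ Icc 0 δ := ⟨hs0, hs.2.trans hxδ.le⟩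
      have hds : dist s 0 < η := by
        rw [dist_eq_norm, Real.norm_eq_abs, sub_zero, abs_of_nonneg hs0]; linarith [hs.2]
      have h1 : ‖h s - h 0‖ ≤ ε / 2 := by
        have := hηε hsI hds; rw [dist_eq_norm] at this; exact this.le
      rw [norm_smul, Real.norm_eq_abs, abs_of_nonneg (Real.rpow_nonneg hs0 _)]
      exact mul_le_mul (Real.rpow_le_rpow hs0 hs.2 hp) h1 (norm_nonneg _) (Real.rpow_nonneg hx.le _)
    have := intervalIntegral.norm_integral_le_of_norm_le_const hle
    rw [sub_zero, abs_of_pos hx] at this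
    calc ‖∫ s in (0 : ℝ)..x, s ^ p • (h s - h 0)‖ ≤ x ^ p * (ε / 2) * x := this
      _ = (ε / 2) * x ^ (p + 1) := by rw [Real.rpow_add_one hx.ne']; ring
  calc (x ^ (p + 1))⁻¹ * ‖∫ s in (0 : ℝ)..x, s ^ p • (h s - h 0)‖
      ≤ (x ^ (p + 1))⁻¹ * ((ε / 2) * x ^ (p + 1)) :=
        mul_le_mul_of_nonneg_left hbound (inv_nonneg.2 hxp.le)
    _ = ε / 2 := by field_simp
    _ < ε := half_lt_self hε

/-! ### The regular branch, real gap -/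

section Main

variable [CompleteSpace E]
set_option maxHeartbeats 400000 in
/-- **THE REGULAR (RECESSIVE) BRANCH AT A SINGULARITY OF THE FIRST KIND, `C¹` COEFFICIENT, REAL GAP.**
Let `K(s) = K₀ + s · G(s)` on `[0, δ₀]` with `G` continuous (`E` a real Banach space), let the residue satisfy
`K₀ ∘ K₀ = −ν K₀` with a real `ν > 0` (spectrum `{0, −ν}`, exponent gap `ν`), and let `v₀ ∈ ker K₀`.  Then for
some `δ ∈ (0, δ₀]` the singular system `x w′ = K(x) w` has a solution on `[0, δ]` with `w(0) = v₀` which is `C¹` up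
to and including `x = 0`: `w, w′` continuous on `[0, δ]`, `w′` is the derivative on `(0, δ)` and the right
derivative at `0`, and `x w′(x) = K(x) w(x)` for all `x ∈ [0, δ]`.  Levinson's theorem (all integrals from the
singular end) in the variable `x = e^{−t}`, with the kernel `(s/x)^ν` a real power; proof by the integral equation
`w = v₀ + (1 − P)∫₀ˣ G w + x^{−ν} P ∫₀ˣ s^ν G w`, `P = −K₀/ν`, as a contraction.
[cite: CoddingtonLevinson1955, Ch. 3 §8 Theorem 8.1 and eq. (8.13)] -/
theorem exists_regularBranch_real {K G : ℝ → E →L[ℝ] E} {K₀ : E →L[ℝ] E} {v₀ : E} {δ₀ ν : ℝ}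
    (hδ₀ : 0 < δ₀) (hν : 0 < ν) (hG : ContinuousOn G (Icc 0 δ₀))
    (hK : ∀ s ∈ Icc 0 δ₀, K s = K₀ + s • G s)
    (hK₀ : K₀.comp K₀ = -(ν • K₀)) (he : K₀ v₀ = 0) :
    ∃ δ : ℝ, ∃ w w' : ℝ → E, 0 < δ ∧ δ ≤ δ₀ ∧ w 0 = v₀ ∧
      ContinuousOn w (Icc 0 δ) ∧ ContinuousOn w' (Icc 0 δ) ∧
      (∀ x ∈ Ioo 0 δ, HasDerivAt w (w' x) x) ∧ HasDerivWithinAt w (w' 0) (Ici 0) 0 ∧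
      (∀ x ∈ Icc 0 δ, x • w' x = K x (w x)) := by
  classical
  have hn0 : ν ≠ 0 := hν.ne'
  have hνc : Continuous fun s : ℝ => s ^ ν := Real.continuous_rpow_const hν.le
  have hν1c : Continuous fun s : ℝ => s ^ (ν + 1) := Real.continuous_rpow_const (by linarith)
  /- the projection `P = −K₀/ν` onto the `−ν`-eigenspace -/
  set P : E →L[ℝ] E := -(ν⁻¹ • K₀) with hPdef
  have hPapply : ∀ v, P v = -(ν⁻¹ • K₀ v) := fun v => by
    simp only [hPdef, neg_apply, smul_apply]
  have hK₀K₀ : ∀ v, K₀ (K₀ v) = -(ν • K₀ v) := fun v => by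
    have h := congrArg (fun T : E →L[ℝ] E => T v) hK₀
    simpa using h
  have hK₀P : ∀ v, K₀ v = -(ν • P v) := fun v => by
    rw [hPapply, smul_neg, neg_neg, smul_smul, mul_inv_cancel₀ hn0, one_smul]
  have hK₀Pv : ∀ v, K₀ (P v) = K₀ v := fun v => by
    rw [hPapply, map_neg, map_smul, hK₀K₀, smul_neg, neg_neg, smul_smul, inv_mul_cancel₀ hn0, one_smul]
  have hPP : ∀ v, P (P v) = P v := fun v => by
    rw [hPapply (P v), hK₀Pv, ← hPapply]
  have hPe : P v₀ = 0 := by rw [hPapply, he, smul_zero, neg_zero]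
  /- `‖G‖ ≤ Cg` on `[0, δ₀]` and the globally continuous clamped coefficient `Gc` -/
  obtain ⟨C₀, hC₀⟩ := isCompact_Icc.exists_bound_of_continuousOn hG
  set Cg : ℝ := max C₀ 0 with hCgdef
  have hCg0 : 0 ≤ Cg := le_max_right _ _
  have hGle : ∀ s ∈ Icc 0 δ₀, ‖G s‖ ≤ Cg := fun s hs => (hC₀ s hs).trans (le_max_left _ _)
  set cl : ℝ → ℝ := fun s => max 0 (min δ₀ s) with hcl
  have hcl_mem : ∀ s, cl s ∈ Icc 0 δ₀ := fun s =>
    ⟨le_max_left _ _, max_le hδ₀.le (min_le_left _ _)⟩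
  have hcl_id : ∀ s ∈ Icc 0 δ₀, cl s = s := fun s hs => by
    simp only [hcl, min_eq_right hs.2, max_eq_right hs.1]
  have hcl_cont : Continuous cl := continuous_const.max (continuous_const.min continuous_id)
  set Gc : ℝ → E →L[ℝ] E := fun s => G (cl s) with hGc
  have hGc_cont : Continuous Gc := hG.comp_continuous hcl_cont hcl_mem
  have hGc_eq : ∀ s ∈ Icc 0 δ₀, Gc s = G s := fun s hs => by simp only [hGc, hcl_id s hs]
  have hGc_le : ∀ s, ‖Gc s‖ ≤ Cg := fun s => hGle _ (hcl_mem s)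
  /- constants: `L = (1 + 2‖P‖) Cg`, `δ L ≤ 1/2` -/
  set L : ℝ := (1 + 2 * ‖P‖) * Cg with hL
  have hL0 : 0 ≤ L := by positivity
  set δ : ℝ := min δ₀ (1 / (2 * (L + 1))) with hδdef
  have hδpos : 0 < δ := lt_min hδ₀ (by positivity)
  have hδle : δ ≤ δ₀ := min_le_left _ _
  have hδL : δ * L ≤ 1 / 2 := by
    have h1 : δ ≤ 1 / (2 * (L + 1)) := min_le_right _ _
    have h2 : 1 / (2 * (L + 1)) * L ≤ 1 / 2 := by
      rw [div_mul_eq_mul_div, one_mul, div_le_iff₀ (by positivity)]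
      nlinarith
    exact (mul_le_mul_of_nonneg_right h1 hL0).trans h2
  have hIccδ : Icc 0 δ ⊆ Icc 0 δ₀ := Icc_subset_Icc_right hδle
  /- the clamp into `[0, δ]` -/
  set c : ℝ → ℝ := fun x => max 0 (min δ x) with hc
  have hc_mem : ∀ x, c x ∈ Icc 0 δ := fun x => ⟨le_max_left _ _, max_le hδpos.le (min_le_left _ _)⟩
  have hc_id : ∀ x ∈ Icc 0 δ, c x = x := fun x hx => by
    simp only [hc, min_eq_right hx.2, max_eq_right hx.1]
  have hc_cont : Continuous c := continuous_const.max (continuous_const.min continuous_id)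
  /- the two integrals -/
  set I₁ : (ℝ → E) → ℝ → E := fun φ y => ∫ s in (0 : ℝ)..y, Gc s (φ s) with hI₁
  set I₂ : (ℝ → E) → ℝ → E := fun φ y => ∫ s in (0 : ℝ)..y, s ^ ν • Gc s (φ s) with hI₂
  have hint₁ : ∀ {φ : ℝ → E}, Continuous φ → Continuous fun s => Gc s (φ s) := fun hφ =>
    hGc_cont.clm_apply hφ
  have hint₂ : ∀ {φ : ℝ → E}, Continuous φ → Continuous fun s => s ^ ν • Gc s (φ s) := fun hφ =>
    hνc.smul (hint₁ hφ)
  have hI₁c : ∀ {φ : ℝ → E}, Continuous φ → Continuous (I₁ φ) := fun hφ =>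
    intervalIntegral.continuous_primitive (fun a b => (hint₁ hφ).intervalIntegrable a b) 0
  have hI₂c : ∀ {φ : ℝ → E}, Continuous φ → Continuous (I₂ φ) := fun hφ =>
    intervalIntegral.continuous_primitive (fun a b => (hint₂ hφ).intervalIntegrable a b) 0
  have hI₁d : ∀ {φ : ℝ → E}, Continuous φ → ∀ y, HasDerivAt (I₁ φ) (Gc y (φ y)) y := fun hφ y =>
    intervalIntegral.integral_hasDerivAt_right ((hint₁ hφ).intervalIntegrable _ _)
      ((hint₁ hφ).stronglyMeasurableAtFilter _ _) (hint₁ hφ).continuousAt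
  have hI₂d : ∀ {φ : ℝ → E}, Continuous φ → ∀ y, HasDerivAt (I₂ φ) (y ^ ν • Gc y (φ y)) y :=
    fun hφ y =>
    intervalIntegral.integral_hasDerivAt_right ((hint₂ hφ).intervalIntegrable _ _)
      ((hint₂ hφ).stronglyMeasurableAtFilter _ _) (hint₂ hφ).continuousAt
  have hI₁0 : ∀ φ : ℝ → E, I₁ φ 0 = 0 := fun φ => by simp only [hI₁, intervalIntegral.integral_same]
  have hI₂0 : ∀ φ : ℝ → E, I₂ φ 0 = 0 := fun φ => by simp only [hI₂, intervalIntegral.integral_same]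
  have hI₁b : ∀ {φ : ℝ → E} {B : ℝ}, (∀ s, ‖φ s‖ ≤ B) → ∀ {y : ℝ}, 0 ≤ y →
      ‖I₁ φ y‖ ≤ Cg * B * y := by
    intro φ B hB y hy
    have hle : ∀ s ∈ Set.uIoc (0 : ℝ) y, ‖Gc s (φ s)‖ ≤ Cg * B := fun s _ =>
      ((Gc s).le_opNorm _).trans (mul_le_mul (hGc_le s) (hB s) (norm_nonneg _) hCg0)
    have h := intervalIntegral.norm_integral_le_of_norm_le_const hle
    rwa [sub_zero, abs_of_nonneg hy] at h
  have hI₂b : ∀ {φ : ℝ → E} {B : ℝ}, (∀ s, ‖φ s‖ ≤ B) → ∀ {y : ℝ}, 0 ≤ y →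
      ‖I₂ φ y‖ ≤ y ^ ν * (Cg * B) * y := by
    intro φ B hB y hy
    have hB0 : 0 ≤ B := (norm_nonneg _).trans (hB 0)
    have hle : ∀ s ∈ Set.uIoc (0 : ℝ) y, ‖s ^ ν • Gc s (φ s)‖ ≤ y ^ ν * (Cg * B) := by
      intro s hs
      rw [uIoc_of_le hy] at hs
      rw [norm_smul, Real.norm_eq_abs, abs_of_nonneg (Real.rpow_nonneg hs.1.le _)]
      exact mul_le_mul (Real.rpow_le_rpow hs.1.le hs.2 hν.le)
        (((Gc s).le_opNorm _).trans (mul_le_mul (hGc_le s) (hB s) (norm_nonneg _) hCg0))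
        (norm_nonneg _) (Real.rpow_nonneg hy _)
    have h := intervalIntegral.norm_integral_le_of_norm_le_const hle
    rwa [sub_zero, abs_of_nonneg hy] at h
  -- the singular term `J y = y^{−ν} P I₂(y)`: bound and continuity on `[0, δ]`
  have hJb : ∀ {φ : ℝ → E} {B : ℝ}, (∀ s, ‖φ s‖ ≤ B) → ∀ {y : ℝ}, 0 ≤ y →
      ‖(y ^ ν)⁻¹ • P (I₂ φ y)‖ ≤ ‖P‖ * (Cg * B) * y := by
    intro φ B hB y hy
    have hB0 : 0 ≤ B := (norm_nonneg _).trans (hB 0)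
    rcases hy.eq_or_lt with rfl | hy'
    · simp [hI₂0]
    · have hyn : 0 < y ^ ν := Real.rpow_pos_of_pos hy' _
      rw [norm_smul, norm_inv, Real.norm_eq_abs, abs_of_pos hyn]
      calc (y ^ ν)⁻¹ * ‖P (I₂ φ y)‖ ≤ (y ^ ν)⁻¹ * (‖P‖ * (y ^ ν * (Cg * B) * y)) :=
            mul_le_mul_of_nonneg_left ((P.le_opNorm _).trans
              (mul_le_mul_of_nonneg_left (hI₂b hB hy) (norm_nonneg _))) (inv_nonneg.2 hyn.le)
        _ = ‖P‖ * (Cg * B) * y := by field_simp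
  have hJc : ∀ {φ : ℝ → E} {B : ℝ}, Continuous φ → (∀ s, ‖φ s‖ ≤ B) →
      ContinuousOn (fun y => (y ^ ν)⁻¹ • P (I₂ φ y)) (Icc 0 δ) := by
    intro φ B hφ hB y hy
    have hB0 : 0 ≤ B := (norm_nonneg _).trans (hB 0)
    rcases hy.1.eq_or_lt with rfl | hy'
    · -- at `0`: squeezed by `‖J y‖ ≤ ‖P‖ Cg B y`
      rw [Metric.continuousWithinAt_iff]
      intro ε hε
      refine ⟨ε / (‖P‖ * (Cg * B) + 1), by positivity, fun y hyI hyd => ?_⟩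
      rw [dist_eq_norm, Real.norm_eq_abs, sub_zero, abs_of_nonneg hyI.1] at hyd
      have h0 : ((0 : ℝ) ^ ν)⁻¹ • P (I₂ φ 0) = 0 := by simp [hI₂0]
      rw [h0, dist_zero_right]
      calc ‖(y ^ ν)⁻¹ • P (I₂ φ y)‖ ≤ ‖P‖ * (Cg * B) * y := hJb hB hyI.1
        _ ≤ (‖P‖ * (Cg * B) + 1) * y := by nlinarith [hyI.1]
        _ < (‖P‖ * (Cg * B) + 1) * (ε / (‖P‖ * (Cg * B) + 1)) := by
            exact mul_lt_mul_of_pos_left hyd (by positivity)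
        _ = ε := by field_simp
    · exact ((hνc.continuousAt.inv₀ (Real.rpow_pos_of_pos hy' _).ne').smul
        (P.continuous.continuousAt.comp (hI₂c hφ).continuousAt)).continuousWithinAt
  /- the Volterra operator, frozen at `δ` -/
  set Top : (ℝ → E) → ℝ → E := fun φ x =>
    v₀ + (I₁ φ (c x) - P (I₁ φ (c x))) + ((c x) ^ ν)⁻¹ • P (I₂ φ (c x)) with hTop
  have hTop_cont : ∀ {φ : ℝ → E} {B : ℝ}, Continuous φ → (∀ s, ‖φ s‖ ≤ B) → Continuous (Top φ) := by
    intro φ B hφ hB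
    have h1 : Continuous fun x => I₁ φ (c x) := (hI₁c hφ).comp hc_cont
    have h2 : Continuous fun x => (c x ^ ν)⁻¹ • P (I₂ φ (c x)) :=
      (hJc hφ hB).comp_continuous hc_cont hc_mem
    simp only [hTop]
    exact (continuous_const.add (h1.sub (P.continuous.comp h1))).add h2
  have hTop_bd : ∀ {φ : ℝ → E} {B : ℝ}, (∀ s, ‖φ s‖ ≤ B) → ∀ x,
      ‖Top φ x‖ ≤ ‖v₀‖ + L * B * δ := by
    intro φ B hB x
    have hB0 : 0 ≤ B := (norm_nonneg _).trans (hB 0)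
    have hy := hc_mem x
    have e1 : ‖I₁ φ (c x) - P (I₁ φ (c x))‖ ≤ (1 + ‖P‖) * (Cg * B * c x) := by
      calc ‖I₁ φ (c x) - P (I₁ φ (c x))‖ ≤ ‖I₁ φ (c x)‖ + ‖P (I₁ φ (c x))‖ := norm_sub_le _ _
        _ ≤ ‖I₁ φ (c x)‖ + ‖P‖ * ‖I₁ φ (c x)‖ := by gcongr; exact P.le_opNorm _
        _ = (1 + ‖P‖) * ‖I₁ φ (c x)‖ := by ring
        _ ≤ (1 + ‖P‖) * (Cg * B * c x) :=
            mul_le_mul_of_nonneg_left (hI₁b hB hy.1) (by positivity)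
    have e2 := hJb hB hy.1 (φ := φ)
    calc ‖Top φ x‖ ≤ ‖v₀‖ + ‖I₁ φ (c x) - P (I₁ φ (c x))‖ + ‖(c x ^ ν)⁻¹ • P (I₂ φ (c x))‖ := by
          simp only [hTop]; exact norm_add₃_le
      _ ≤ ‖v₀‖ + (1 + ‖P‖) * (Cg * B * c x) + ‖P‖ * (Cg * B) * c x := by gcongr
      _ = ‖v₀‖ + L * B * c x := by simp only [hL]; ring
      _ ≤ ‖v₀‖ + L * B * δ := by gcongr; exact hy.2
  -- on bounded continuous functions
  have hnorm_le : ∀ (f : ℝ →ᵇ E) (s : ℝ), ‖f s‖ ≤ ‖f‖ := fun f s => f.norm_coe_le_norm s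
  have hT_bd : ∀ f : ℝ →ᵇ E, ∀ x, ‖Top f x‖ ≤ ‖v₀‖ + L * ‖f‖ * δ := fun f x =>
    hTop_bd (hnorm_le f) x
  set T : (ℝ →ᵇ E) → (ℝ →ᵇ E) := fun f =>
    BoundedContinuousFunction.ofNormedAddCommGroup (Top f) (hTop_cont f.continuous (hnorm_le f))
      (‖v₀‖ + L * ‖f‖ * δ) (hT_bd f) with hT
  have hT_apply : ∀ (f : ℝ →ᵇ E) (x : ℝ), T f x = Top f x := fun f x => rfl
  -- the difference of two images
  have hTop_sub : ∀ (f g : ℝ →ᵇ E) (x : ℝ), Top f x - Top g x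
      = (I₁ (⇑(f - g)) (c x) - P (I₁ (⇑(f - g)) (c x))) + ((c x) ^ ν)⁻¹ • P (I₂ (⇑(f - g)) (c x)) := by
    intro f g x
    have d1 : I₁ (⇑(f - g)) (c x) = I₁ f (c x) - I₁ g (c x) := by
      simp only [hI₁, BoundedContinuousFunction.coe_sub, Pi.sub_apply, map_sub]
      exact intervalIntegral.integral_sub ((hint₁ f.continuous).intervalIntegrable _ _)
        ((hint₁ g.continuous).intervalIntegrable _ _)
    have d2 : I₂ (⇑(f - g)) (c x) = I₂ f (c x) - I₂ g (c x) := by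
      simp only [hI₂, BoundedContinuousFunction.coe_sub, Pi.sub_apply, map_sub, smul_sub]
      exact intervalIntegral.integral_sub ((hint₂ f.continuous).intervalIntegrable _ _)
        ((hint₂ g.continuous).intervalIntegrable _ _)
    simp only [hTop, d1, d2, map_sub, smul_sub]
    abel
  have hT_contr : ContractingWith 2⁻¹ T := by
    refine ⟨inv_lt_one_of_one_lt₀ one_lt_two, LipschitzWith.of_dist_le_mul fun f g => ?_⟩
    rw [BoundedContinuousFunction.dist_le (by positivity)]
    intro x
    rw [dist_eq_norm, hT_apply, hT_apply, hTop_sub]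
    have hB : ∀ s, ‖(f - g) s‖ ≤ dist f g := fun s => by
      rw [BoundedContinuousFunction.coe_sub, Pi.sub_apply, ← dist_eq_norm]; exact f.dist_coe_le_dist s
    have hy := hc_mem x
    have e1 : ‖I₁ (⇑(f - g)) (c x) - P (I₁ (⇑(f - g)) (c x))‖ ≤ (1 + ‖P‖) * (Cg * dist f g * c x) := by
      calc ‖I₁ (⇑(f - g)) (c x) - P (I₁ (⇑(f - g)) (c x))‖
          ≤ ‖I₁ (⇑(f - g)) (c x)‖ + ‖P (I₁ (⇑(f - g)) (c x))‖ := norm_sub_le _ _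
        _ ≤ ‖I₁ (⇑(f - g)) (c x)‖ + ‖P‖ * ‖I₁ (⇑(f - g)) (c x)‖ := by gcongr; exact P.le_opNorm _
        _ = (1 + ‖P‖) * ‖I₁ (⇑(f - g)) (c x)‖ := by ring
        _ ≤ (1 + ‖P‖) * (Cg * dist f g * c x) :=
            mul_le_mul_of_nonneg_left (hI₁b hB hy.1) (by positivity)
    have e2 := hJb hB hy.1 (φ := ⇑(f - g))
    calc ‖I₁ (⇑(f - g)) (c x) - P (I₁ (⇑(f - g)) (c x)) + (c x ^ ν)⁻¹ • P (I₂ (⇑(f - g)) (c x))‖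
        ≤ (1 + ‖P‖) * (Cg * dist f g * c x) + ‖P‖ * (Cg * dist f g) * c x :=
          (norm_add_le _ _).trans (add_le_add e1 e2)
      _ = L * dist f g * c x := by simp only [hL]; ring
      _ ≤ L * dist f g * δ := by gcongr; exact hy.2
      _ = (δ * L) * dist f g := by ring
      _ ≤ (1 / 2) * dist f g := mul_le_mul_of_nonneg_right hδL dist_nonneg
      _ = ((2⁻¹ : NNReal) : ℝ) * dist f g := by norm_num
  /- the fixed point -/
  set u₀ : ℝ →ᵇ E := ContractingWith.fixedPoint T hT_contr with hu₀
  have hfix₀ : T u₀ = u₀ := hT_contr.fixedPoint_isFixedPt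
  set w : ℝ → E := fun x => u₀ x with hw
  have hwc : Continuous w := u₀.continuous
  have hwB : ∀ s, ‖w s‖ ≤ ‖u₀‖ := hnorm_le u₀
  have hfix : ∀ x, w x = Top w x := fun x => by
    have h := congrArg (fun h : ℝ →ᵇ E => h x) hfix₀
    simpa [hT_apply] using h.symm
  -- the integral equation on `[0, δ]`
  have hEQ : ∀ x ∈ Icc 0 δ, w x = v₀ + (I₁ w x - P (I₁ w x)) + (x ^ ν)⁻¹ • P (I₂ w x) := by
    intro x hx
    have h := hfix x
    simp only [hTop, hc_id x hx] at h
    exact h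
  have hw0 : w 0 = v₀ := by
    rw [hEQ 0 ⟨le_rfl, hδpos.le⟩, hI₁0, hI₂0]; simp
  -- `P w = x^{−ν} P I₂` on `[0, δ]`
  have hPw : ∀ x ∈ Icc 0 δ, P (w x) = (x ^ ν)⁻¹ • P (I₂ w x) := by
    intro x hx
    conv_lhs => rw [hEQ x hx]
    rw [map_add, map_add, map_sub, hPe, hPP, sub_self, zero_add, zero_add, map_smul, hPP]
  /- the derivative -/
  set a₀ : E := Gc 0 v₀ with ha₀
  set w'₀ : E := a₀ - (ν * (ν + 1)⁻¹) • P a₀ with hw'₀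
  set w' : ℝ → E := fun y =>
    if y = 0 then w'₀ else Gc y (w y) - (ν * (y ^ (ν + 1))⁻¹) • P (I₂ w y) with hw'
  have hw'_ne : ∀ {y : ℝ}, y ≠ 0 → w' y = Gc y (w y) - (ν * (y ^ (ν + 1))⁻¹) • P (I₂ w y) :=
    fun hy => by simp only [hw', if_neg hy]
  have hw'_0 : w' 0 = w'₀ := by simp only [hw', if_pos rfl]
  -- derivative on `(0, δ)`
  have hderiv : ∀ x ∈ Ioo 0 δ, HasDerivAt w (w' x) x := by
    intro x hx
    have hx0 : x ≠ 0 := hx.1.ne'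
    have hxn : x ^ ν ≠ 0 := (Real.rpow_pos_of_pos hx.1 _).ne'
    -- the right-hand side `F` of the integral equation and its derivative
    have hF1 : HasDerivAt (fun y => I₁ w y - P (I₁ w y)) (Gc x (w x) - P (Gc x (w x))) x :=
      (hI₁d hwc x).sub (P.hasFDerivAt.comp_hasDerivAt x (hI₁d hwc x))
    have hinv : HasDerivAt (fun y : ℝ => (y ^ ν)⁻¹) (-(ν * x ^ (ν - 1)) / (x ^ ν) ^ 2) x :=
      (Real.hasDerivAt_rpow_const (Or.inl hx0)).inv hxn
    have hF2 : HasDerivAt (fun y => (y ^ ν)⁻¹ • P (I₂ w y))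
        ((x ^ ν)⁻¹ • P (x ^ ν • Gc x (w x)) + (-(ν * x ^ (ν - 1)) / (x ^ ν) ^ 2) • P (I₂ w x)) x :=
      hinv.smul (P.hasFDerivAt.comp_hasDerivAt x (hI₂d hwc x))
    have hF : HasDerivAt (fun y => v₀ + (I₁ w y - P (I₁ w y)) + (y ^ ν)⁻¹ • P (I₂ w y)) (w' x) x := by
      refine ((hF1.const_add v₀).add hF2).congr_deriv ?_
      rw [hw'_ne hx0, map_smul, smul_smul, inv_mul_cancel₀ hxn, one_smul]
      have hpow : -(ν * x ^ (ν - 1)) / (x ^ ν) ^ 2 = -(ν * (x ^ (ν + 1))⁻¹) := by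
        have h2 : x ^ (ν - 1) * x ^ (ν + 1) = (x ^ ν) ^ 2 := by
          rw [← Real.rpow_add hx.1, show ν - 1 + (ν + 1) = ν * 2 by ring, Real.rpow_mul hx.1.le,
            Real.rpow_two]
        have hx1 : x ^ (ν - 1) ≠ 0 := (Real.rpow_pos_of_pos hx.1 _).ne'
        have hx2 : x ^ (ν + 1) ≠ 0 := (Real.rpow_pos_of_pos hx.1 _).ne'
        rw [← h2, div_eq_mul_inv, mul_inv, ← mul_assoc, neg_mul, neg_mul, mul_assoc ν,
          mul_inv_cancel₀ hx1, mul_one]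
      rw [hpow, neg_smul]
      abel
    refine hF.congr_of_eventuallyEq ?_
    filter_upwards [Icc_mem_nhds hx.1 hx.2] with y hy using hEQ y hy
  -- the limit of `w'` at `0⁺`
  have hlim : Tendsto w' (𝓝[>] 0) (𝓝 w'₀) := by
    have hh : Continuous fun s => Gc s (w s) := hint₁ hwc
    have hA : Tendsto (fun y : ℝ => (y ^ (ν + 1))⁻¹ • I₂ w y) (𝓝[>] 0)
        (𝓝 (((ν + 1))⁻¹ • a₀)) := by
      have h := tendsto_inv_rpow_smul_integral hδpos (hh.continuousOn (s := Icc 0 δ)) hν.le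
      simp only [hw0] at h
      exact h
    have hB : Tendsto (fun y : ℝ => Gc y (w y)) (𝓝[>] 0) (𝓝 a₀) := by
      have h := (hh.tendsto 0)
      rw [hw0] at h
      exact tendsto_nhdsWithin_of_tendsto_nhds h
    have hC : Tendsto (fun y : ℝ => Gc y (w y) - ν • P ((y ^ (ν + 1))⁻¹ • I₂ w y)) (𝓝[>] 0)
        (𝓝 (a₀ - ν • P ((((ν + 1))⁻¹ • a₀)))) :=
      hB.sub (((P.continuous.tendsto _).comp hA).const_smul ν)
    have heq : (fun y : ℝ => Gc y (w y) - ν • P ((y ^ (ν + 1))⁻¹ • I₂ w y)) =ᶠ[𝓝[>] 0] w' := by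
      filter_upwards [self_mem_nhdsWithin] with y hy
      rw [hw'_ne (ne_of_gt hy), map_smul, smul_smul]
    have hval : a₀ - ν • P ((((ν + 1))⁻¹ • a₀)) = w'₀ := by
      rw [hw'₀, map_smul, smul_smul]
    rw [← hval]
    exact hC.congr' heq
  -- continuity of `w'` on `[0, δ]`
  have hw'c : ContinuousOn w' (Icc 0 δ) := by
    intro y hy
    rcases hy.1.eq_or_lt with rfl | hy'
    · have h1 : ContinuousWithinAt w' (Ioi 0) 0 := by
        show Tendsto _ _ _
        rw [hw'_0]; exact hlim
      exact (continuousWithinAt_Ioi_iff_Ici.1 h1).mono Icc_subset_Ici_self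
    · have hy0 : y ≠ 0 := hy'.ne'
      have hev : w' =ᶠ[𝓝 y] fun z => Gc z (w z) - (ν * (z ^ (ν + 1))⁻¹) • P (I₂ w z) := by
        filter_upwards [isOpen_ne.mem_nhds hy0] with z hz using hw'_ne hz
      refine (ContinuousAt.congr_of_eventuallyEq ?_ hev).continuousWithinAt
      refine (hint₁ hwc).continuousAt.sub (ContinuousAt.smul ?_ ?_)
      · exact continuousAt_const.mul
          ((hν1c.continuousAt).inv₀ (Real.rpow_pos_of_pos hy' _).ne')
      · exact P.continuous.continuousAt.comp (hI₂c hwc).continuousAt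
  -- the right derivative at `0`
  have hderiv0 : HasDerivWithinAt w (w' 0) (Ici 0) 0 := by
    refine hasDerivWithinAt_Ici_of_tendsto_deriv (s := Ioo 0 δ)
      (fun y hy => (hderiv y hy).differentiableAt.differentiableWithinAt)
      hwc.continuousAt.continuousWithinAt (Ioo_mem_nhdsGT hδpos) ?_
    rw [hw'_0]
    refine hlim.congr' ?_
    filter_upwards [Ioo_mem_nhdsGT hδpos] with y hy using ((hderiv y hy).deriv).symm
  /- the equation `x w' = K w` on `[0, δ]` -/
  have hODE : ∀ x ∈ Icc 0 δ, x • w' x = K x (w x) := by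
    intro x hx
    rcases hx.1.eq_or_lt with rfl | hx'
    · rw [zero_smul, hw0, hK 0 ⟨le_rfl, hδ₀.le⟩]
      simp [he]
    · have hx0 : x ≠ 0 := hx'.ne'
      have hxn : x ^ ν ≠ 0 := (Real.rpow_pos_of_pos hx' _).ne'
      rw [hw'_ne hx0, smul_sub, smul_smul, hK x (hIccδ hx), hGc_eq x (hIccδ hx),
        add_apply, smul_apply, hK₀P (w x),
        hPw x hx, smul_smul]
      have hsc : x * (ν * (x ^ (ν + 1))⁻¹) = ν * (x ^ ν)⁻¹ := by
        rw [Real.rpow_add_one hx0]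
        field_simp
      rw [hsc, sub_eq_add_neg, add_comm]
  exact ⟨δ, w, w', hδpos, hδle, hw0, hwc.continuousOn, hw'c, hderiv, hderiv0, hODE⟩

/-- **THE BRANCH `v ∼ x^λ v₀` OF `x v′ = N(x) v` (real exponent).**  Let `N(s) = N₀ + s · G(s)` on `[0, δ₀]`
with `G` continuous, let `λ ∈ ℝ` be an eigenvalue of the residue, `N₀ v₀ = λ v₀`, whose shift `K₀ = N₀ − λ`
satisfies `K₀ ∘ K₀ = −ν K₀` for a real `ν > 0` (for a `2 × 2` residue with real eigenvalues `λ > λ′` this is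
Cayley–Hamilton with `ν = λ − λ′`: `λ` is the LARGER exponent, the branch is the recessive = "small" one).  Then
for some `δ ∈ (0, δ₀]` there is `w`, `C¹` on `[0, δ]` up to the singular point, with `w(0) = v₀` and
`x w′ = N(x) w − λ w` on `[0, δ]`; consequently `v(x) = x^λ w(x)` solves `v′ = x⁻¹ N(x) v` on `(0, δ)` — the
solution behaving like `x^λ v₀` (Freidberg2014 (11.104): `ξ ≈ c₁ x^{p₁} + c₂ x^{p₂}` at a resonant surface, the
small solution `p₁`).  (Apply `exists_regularBranch_real` to `K = N − λ`.)
[cite: CoddingtonLevinson1955, Ch. 3 §8 Theorem 8.1; Ch. 4 §2 (singularity of the first kind)] -/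
theorem exists_regularBranch_rpow {N G : ℝ → E →L[ℝ] E} {N₀ : E →L[ℝ] E} {v₀ : E} {δ₀ μ ν : ℝ}
    (hδ₀ : 0 < δ₀) (hν : 0 < ν) (hG : ContinuousOn G (Icc 0 δ₀))
    (hN : ∀ s ∈ Icc 0 δ₀, N s = N₀ + s • G s)
    (hN₀ : (N₀ - μ • (1 : E →L[ℝ] E)).comp (N₀ - μ • (1 : E →L[ℝ] E))
      = -(ν • (N₀ - μ • (1 : E →L[ℝ] E))))
    (he : N₀ v₀ = μ • v₀) :
    ∃ δ : ℝ, ∃ w w' : ℝ → E, 0 < δ ∧ δ ≤ δ₀ ∧ w 0 = v₀ ∧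
      ContinuousOn w (Icc 0 δ) ∧ ContinuousOn w' (Icc 0 δ) ∧
      (∀ x ∈ Ioo 0 δ, HasDerivAt w (w' x) x) ∧ HasDerivWithinAt w (w' 0) (Ici 0) 0 ∧
      (∀ x ∈ Icc 0 δ, x • w' x = N x (w x) - μ • w x) ∧
      (∀ x ∈ Ioo 0 δ, HasDerivAt (fun y => y ^ μ • w y) (x⁻¹ • N x (x ^ μ • w x)) x) := by
  -- the shifted coefficient `K = N − μ`
  set K₀ : E →L[ℝ] E := N₀ - μ • (1 : E →L[ℝ] E) with hK₀def
  set K : ℝ → E →L[ℝ] E := fun s => N s - μ • (1 : E →L[ℝ] E) with hKdef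
  have hK₀apply : ∀ v, K₀ v = N₀ v - μ • v := fun v => by
    simp only [hK₀def, sub_apply, smul_apply, one_apply_eq_self]
  have hKapply : ∀ s v, K s v = N s v - μ • v := fun s v => by
    simp only [hKdef, sub_apply, smul_apply, one_apply_eq_self]
  have hK : ∀ s ∈ Icc 0 δ₀, K s = K₀ + s • G s := fun s hs => by
    simp only [hKdef, hK₀def, hN s hs]; abel
  have heK : K₀ v₀ = 0 := by rw [hK₀apply, he, sub_self]
  obtain ⟨δ, w, w', hδ, hδle, hw0, hwc, hw'c, hd, hd0, hode⟩ :=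
    exists_regularBranch_real hδ₀ hν hG hK hN₀ heK
  refine ⟨δ, w, w', hδ, hδle, hw0, hwc, hw'c, hd, hd0, fun x hx => by rw [hode x hx, hKapply], ?_⟩
  intro x hx
  have hx0 : x ≠ 0 := hx.1.ne'
  have hxw : x • w' x = N x (w x) - μ • w x := by rw [hode x (Ioo_subset_Icc_self hx), hKapply]
  have h := ((Real.hasDerivAt_rpow_const (p := μ) (Or.inl hx0)).smul (hd x hx))
  refine h.congr_deriv ?_
  -- `x^μ • w' + (μ x^{μ-1}) • w = x⁻¹ • N(x) (x^μ • w)`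
  rw [map_smul, smul_smul]
  have e1 : x ^ μ • w' x = (x ^ μ * x⁻¹) • (x • w' x) := by
    rw [smul_smul, mul_assoc, inv_mul_cancel₀ hx0, mul_one]
  have e2 : μ * x ^ (μ - 1) = (x ^ μ * x⁻¹) * μ := by
    rw [Real.rpow_sub_one hx0]
    field_simp
  rw [e1, hxw, e2, smul_sub, ← smul_smul (x ^ μ * x⁻¹) μ, sub_add_cancel, mul_comm]

end Main

end Literature.Analysis.ODE
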